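import Literature.AlgebraicGeometry.GaoUllmo2025.CMHodgeModel
import Mathlib.LinearAlgebra.Matrix.Determinant.Basic
import Mathlib.LinearAlgebra.Basis.Basic
import HarnessLib

/-!
# Gao–Ullmo 2025, Theorem 3.1 (Pohlmann), first half: rational Hodge classes are supported on sets satisfying (3.2)

Z. Gao, E. Ullmo, *Hodge cycles and quadratic relations between holomorphic periods on CM abelian varieties*,
J. Inst. Math. Jussieu **25** (2025) 215–249 = arXiv:2411.12249 [GaoUllmo2025], §3.1, proof of Theorem 3.1, first
paragraph (art. p. 11, chunk p0012 L12 of the held published text `corpus:paper:galaxy-pdf-4667137180`), verbatim: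
"Each element of `B^p(A) ⊆ B^p(A) ⊗ ℂ` can be written as a linear combination `f = Σ_j c_j[P_j] ∈ B^p(A)` with
`c_j ∈ ℂ` and `P_j ∈ 𝒫(S)` with `|P_j| = 2p`. For each `τ ∈ Aut(ℂ/ℚ)`, we then have
`Σ_j τ(c_j)[τP_j] = τ(f) = f ∈ H^{p,p}(A, ℂ)`. So each `P_j` satisfies (3.2). Hence every element of `B^p(A)` is a
`ℂ`-linear combination of `[P]` with `P ∈ 𝒫(S)` satisfying (3.2), and so the same holds true for every element of
`B^p(A) ⊗ ℂ`."

Over the typed model of `Literature.AlgebraicGeometry.GaoUllmo2025.CMHodgeModel` this becomes, for ANY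
finite-dimensional commutative `ℚ`-algebra `E` and any linear order on `S = Hom(E, ℂ)`:

* `exists_sign_coord_galois` — for `σ ∈ G = Gal(E^c/ℚ)` and `P ∈ 𝒫_r(S)` there is a sign `ε = ±1` with
  `σ(x_P) = ε · x_{σP}` for the `[P]`-coordinate `x_P ∈ E^c` of every RATIONAL class `x ∈ H^r(A, ℚ)` (the printed
  `τ(f) = f`, with `Aut(ℂ/ℚ)` replaced by `G` acting on `E^c`-valued coordinates; the sign is that of the
  permutation by which `σ` reorders the increasing enumeration of `P`, `exists_perm_enum`);
* `type_of_repr_ne_zero_of_mem_Hpp` — a class in `H^{p,p}` has non-zero coordinates only at sets of type `(p,p)`;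
* `span_Bp_le` — **Theorem 3.1, first half (`⊆`)**: `B^p(A) ⊗ ℂ ⊆ span_ℂ {[P] : |P| = 2p, P satisfies (3.2)}`.

The second half and the statement of Theorem 3.1 are in `Literature.AlgebraicGeometry.GaoUllmo2025.Theorem31`.

## References

* [GaoUllmo2025] Z. Gao, E. Ullmo, J. Inst. Math. Jussieu 25 (2025) 215–249 — Theorem 3.1 and its proof, §3.1,
  art. p. 11 (first paragraph of the proof).

## Provenance

Staged by the pub-hodgecm formalisation cell (lineage `pub-hodgecm-pohl`) under the LEAN-IN-TREE rule; supersedes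
§§GalInj, Thm31Le of the standalone package's `HodgeCM/Literature/GaoUllmoTheorem31.lean` (gate run 20; its
`Theorem31_le` is `span_Bp_le` here), namespace `HodgeCM.GaoUllmo` ↦ `Literature.AlgebraicGeometry.GaoUllmo2025`.
-/

noncomputable section

open Module

attribute [local instance] Classical.propDecidable

namespace Literature.AlgebraicGeometry.GaoUllmo2025

section GalInj

variable {E : Type} [CommRing E] [Algebra ℚ E]

/-- `σ ∈ Gal(E^c/ℚ)` acts injectively on `Hom(E, ℂ)`. [folklore] -/
theorem galAct_injective (σ : galoisClosure E ≃ₐ[ℚ] galoisClosure E) : Function.Injective (galAct E σ) := by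
  intro φ ψ h
  ext a
  have h1 : (σ (corestrict E φ a) : ℂ) = σ (corestrict E ψ a) := by
    rw [← galAct_apply, ← galAct_apply, h]
  have h2 : corestrict E φ a = corestrict E ψ a := σ.injective (Subtype.ext h1)
  simpa using congrArg (fun z : galoisClosure E => (z : ℂ)) h2

/-- `|σP| = |P|`. [folklore] -/
theorem card_galActSet (σ : galoisClosure E ≃ₐ[ℚ] galoisClosure E) {r : ℕ} (P : Set.powersetCard (Emb E) r) :
    (galActSet E σ (P : Finset (Emb E))).card = r := by
  rw [galActSet, Finset.card_image_of_injective _ (galAct_injective σ)]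
  exact P.prop

/-- `σP` as an element of `𝒫_r(S)` (§3.1, chunk p0012 L1: "the Galois group `G = Gal(E^c/ℚ)` operates on `𝒫(S)`").
[cite: GaoUllmo2025, §3.1] -/
def galActPC (σ : galoisClosure E ≃ₐ[ℚ] galoisClosure E) {r : ℕ} (P : Set.powersetCard (Emb E) r) :
    Set.powersetCard (Emb E) r :=
  Set.powersetCard.ofCard (card_galActSet σ P)

/-- The underlying `Finset` of `galActPC σ P` is `σP`. [folklore] -/
@[simp] theorem galActPC_val (σ : galoisClosure E ≃ₐ[ℚ] galoisClosure E) {r : ℕ}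
    (P : Set.powersetCard (Emb E) r) :
    ((galActPC σ P : Set.powersetCard (Emb E) r) : Finset (Emb E)) = galActSet E σ (P : Finset (Emb E)) := rfl

variable [LinearOrder (Emb E)]

/-- The increasing enumerations of `P` and of `σP` differ, after applying `σ`, by a permutation of `{1,…,r}`.
[folklore] -/
theorem exists_perm_enum (σ : galoisClosure E ≃ₐ[ℚ] galoisClosure E) {r : ℕ} (P : Set.powersetCard (Emb E) r) :
    ∃ π : Equiv.Perm (Fin r), ∀ j,
      galAct E σ (Set.powersetCard.ofFinEmbEquiv.symm P j) =
        Set.powersetCard.ofFinEmbEquiv.symm (galActPC σ P) (π j) := by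
  set eP := Set.powersetCard.ofFinEmbEquiv.symm P with heP
  set eQ := Set.powersetCard.ofFinEmbEquiv.symm (galActPC σ P) with heQ
  have hmem : ∀ j, ∃ m, eQ m = galAct E σ (eP j) := by
    intro j
    have hj : eP j ∈ P := (Set.powersetCard.mem_range_ofFinEmbEquiv_symm_iff_mem P _).mp ⟨j, rfl⟩
    have hj' : galAct E σ (eP j) ∈ galActPC σ P := by
      show galAct E σ (eP j) ∈ ((galActPC σ P : Set.powersetCard (Emb E) r) : Finset (Emb E))
      rw [galActPC_val, galActSet]
      exact Finset.mem_image_of_mem _ hj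
    exact (Set.powersetCard.mem_range_ofFinEmbEquiv_symm_iff_mem _ _).mpr hj'
  choose g hg using hmem
  have hginj : Function.Injective g := by
    intro j j' h
    have : galAct E σ (eP j) = galAct E σ (eP j') := by rw [← hg j, ← hg j', h]
    exact eP.injective (galAct_injective σ this)
  refine ⟨Equiv.ofBijective g (Finite.injective_iff_bijective.mp hginj), fun j => ?_⟩
  rw [Equiv.ofBijective_apply, hg]

end GalInj

section Thm31Le

variable {E : Type} [CommRing E] [Algebra ℚ E] [Module.Finite ℚ E] [LinearOrder (Emb E)]

/-- The basis `([P])_{P ∈ 𝒫_r(S)}` of `⋀^r ℂ^S` (Mathlib's `Basis.exteriorPower` of the standard basis of `ℂ^S`).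
[folklore] -/
abbrev wedgeBasis (E : Type) [CommRing E] [Algebra ℚ E] [Module.Finite ℚ E] [LinearOrder (Emb E)] (r : ℕ) :
    Basis (Set.powersetCard (Emb E) r) ℂ (Hr E r) :=
  (Pi.basisFun ℂ (Emb E)).exteriorPower r

/-- `wedgeBasis E r P = [P]`. [folklore] -/
theorem wedgeBasis_apply (r : ℕ) (P : Set.powersetCard (Emb E) r) : wedgeBasis E r P = wedge E r P := rfl

/-- The `[Q]`-coordinate of `v₁ ∧ ⋯ ∧ v_r` is the minor `det (v_i(φ_j))`, `φ₁ < ⋯ < φ_r` the elements of `Q`.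
[folklore] -/
theorem repr_ιMulti_eq_det (r : ℕ) (v : Fin r → VC E) (Q : Set.powersetCard (Emb E) r) :
    (wedgeBasis E r).repr (exteriorPower.ιMulti ℂ r v) Q =
      (Matrix.of fun i j => v i (Set.powersetCard.ofFinEmbEquiv.symm Q j)).det := by
  rw [← Basis.coord_apply, exteriorPower.basis_coord, exteriorPower.ιMultiDual_apply_ιMulti]
  congr 1

/-- **Coordinate equivariance on rational classes.**  For `σ ∈ G` and `P ∈ 𝒫_r(S)` there is a sign `ε = ±1` such
that for every RATIONAL class `x ∈ H^r(A, ℚ)` the `[P]`-coordinate `x_P` lies in `E^c` and `σ(x_P) = ε · x_{σP}`.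
(This is the content of the printed "`Σ_j τ(c_j)[τP_j] = τ(f) = f`" for `f ∈ H^{2p}(A, ℚ)`, proof of Thm 3.1, art.
p. 11, chunk p0012 L12.) [cite: GaoUllmo2025, Thm 3.1 (proof, first paragraph)] -/
theorem exists_sign_coord_galois (σ : galoisClosure E ≃ₐ[ℚ] galoisClosure E) (r : ℕ)
    (P : Set.powersetCard (Emb E) r) :
    ∃ ε : ℂ, (ε = 1 ∨ ε = -1) ∧ ∀ x ∈ ratStr E r, ∃ y : galoisClosure E,
      (y : ℂ) = (wedgeBasis E r).repr x P ∧
        ((σ y : galoisClosure E) : ℂ) = ε * (wedgeBasis E r).repr x (galActPC σ P) := by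
  obtain ⟨π, hπ⟩ := exists_perm_enum σ P
  refine ⟨((Equiv.Perm.sign π : ℤˣ) : ℤ), ?_, ?_⟩
  · rcases Int.units_eq_one_or (Equiv.Perm.sign π) with h | h <;> simp [h]
  intro x hx
  induction hx using Submodule.span_induction with
  | mem x hx =>
    obtain ⟨a, rfl⟩ := hx
    set eP := Set.powersetCard.ofFinEmbEquiv.symm P with heP
    set eQ := Set.powersetCard.ofFinEmbEquiv.symm (galActPC σ P) with heQ
    -- the minor with entries in `E^c`
    let ML : Matrix (Fin r) (Fin r) (galoisClosure E) := Matrix.of fun i j => corestrict E (eP j) (a i)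
    refine ⟨ML.det, ?_, ?_⟩
    · rw [repr_ιMulti_eq_det]
      have : (ML.det : ℂ) = (algebraMap (galoisClosure E) ℂ) ML.det := rfl
      rw [this, RingHom.map_det]
      congr 1
    · rw [repr_ιMulti_eq_det]
      have h1 : ((σ ML.det : galoisClosure E) : ℂ) = (algebraMap (galoisClosure E) ℂ) (σ ML.det) := rfl
      rw [h1, AlgEquiv.map_det, RingHom.map_det]
      have h2 : (algebraMap (galoisClosure E) ℂ).mapMatrix (σ.mapMatrix ML) =
          (Matrix.of fun i j => ratVec E (a i) (eQ j)).submatrix id π := by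
        ext i j
        simp only [RingHom.mapMatrix_apply, AlgEquiv.mapMatrix_apply, Matrix.map_apply, Matrix.submatrix_apply,
          id_eq, Matrix.of_apply, ML]
        rw [← hπ j, ratVec_apply, galAct_apply]
        rfl
      rw [h2, Matrix.det_permute']
  | zero => exact ⟨0, by simp, by simp⟩
  | add x y _ _ hx hy =>
    obtain ⟨y₁, h₁, h₁'⟩ := hx
    obtain ⟨y₂, h₂, h₂'⟩ := hy
    refine ⟨y₁ + y₂, ?_, ?_⟩
    · simp [h₁, h₂]
    · simp [h₁', h₂', mul_add]
  | smul q x _ hx =>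
    obtain ⟨y₁, h₁, h₁'⟩ := hx
    have hq : (q • x : Hr E r) = (q : ℂ) • x := (algebraMap_smul ℂ q x).symm
    have hcoe : ((algebraMap ℚ (galoisClosure E) q : galoisClosure E) : ℂ) = (q : ℂ) := by
      have : ((algebraMap ℚ (galoisClosure E) q : galoisClosure E) : ℂ) =
          algebraMap (galoisClosure E) ℂ (algebraMap ℚ (galoisClosure E) q) := rfl
      rw [this, ← IsScalarTower.algebraMap_apply]
      simp
    refine ⟨algebraMap ℚ _ q * y₁, ?_, ?_⟩
    · rw [hq, map_smul, Finsupp.smul_apply, smul_eq_mul, ← h₁]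
      push_cast
      rw [hcoe]
    · rw [hq, map_smul, Finsupp.smul_apply, smul_eq_mul, map_mul, AlgEquiv.commutes]
      push_cast
      rw [hcoe, h₁']
      ring

/-- `H^{p,p}` is the span of part of the basis `([P])_P`: a class in `H^{p,p}` has non-zero coordinates only at sets
`Q` of type `(p,p)` (§3.1, chunk p0011 L31: "`H^{p,q}(A, ℂ)` … has a basis consisting of the `[P]` such that
`|P ∩ Φ| = p` and `|P ∩ Φ̄| = q`"). [cite: GaoUllmo2025, §3.1] -/
theorem type_of_repr_ne_zero_of_mem_Hpp (Φ : CMTypeOn E) (p : ℕ) {x : Hr E (2 * p)} (hx : x ∈ Hpp Φ p)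
    (Q : Set.powersetCard (Emb E) (2 * p)) (hQ : (wedgeBasis E (2 * p)).repr x Q ≠ 0) :
    ((Q : Finset (Emb E)) ∩ Φ.Φ).card = p ∧ ((Q : Finset (Emb E)) ∩ Φ.bar).card = p := by
  have hset : {x : Hr E (2 * p) | ∃ P : Set.powersetCard (Emb E) (2 * p),
      ((P : Finset (Emb E)) ∩ Φ.Φ).card = p ∧ ((P : Finset (Emb E)) ∩ Φ.bar).card = p ∧ x = wedge E (2 * p) P} =
      wedgeBasis E (2 * p) ''
        {P | ((P : Finset (Emb E)) ∩ Φ.Φ).card = p ∧ ((P : Finset (Emb E)) ∩ Φ.bar).card = p} := by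
    ext y
    simp only [Set.mem_setOf_eq, Set.mem_image, wedgeBasis_apply]
    constructor
    · rintro ⟨P, h1, h2, rfl⟩; exact ⟨P, ⟨h1, h2⟩, rfl⟩
    · rintro ⟨P, ⟨h1, h2⟩, rfl⟩; exact ⟨P, h1, h2, rfl⟩
  have hx' : x ∈ Submodule.span ℂ (wedgeBasis E (2 * p) ''
      {P | ((P : Finset (Emb E)) ∩ Φ.Φ).card = p ∧ ((P : Finset (Emb E)) ∩ Φ.bar).card = p}) := by
    rw [← hset]; exact hx
  have hsupp := (Basis.mem_span_image _).mp hx'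
  exact hsupp (Finsupp.mem_support_iff.mpr hQ)

/-- **Theorem 3.1 (Pohlmann), first half (`⊆`)**, kernel-proved over the typed model for ANY finite-dimensional
commutative `ℚ`-algebra `E` and any ordering of `S`: every class of `B^p(A) = H^{2p}(A, ℚ) ∩ H^{p,p}` — hence of
`B^p(A) ⊗ ℂ` — is a combination of the `[P]` with `P` satisfying (3.2).  This is the first paragraph of the printed
proof (art. p. 11, chunk p0012 L12: "For each `τ ∈ Aut(ℂ/ℚ)`, we then have `Σ_j τ(c_j)[τP_j] = τ(f) = f ∈ H^{p,p}(A, ℂ)`.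
So each `P_j` satisfies (3.2)."), with `Aut(ℂ/ℚ)` replaced by `G = Gal(E^c/ℚ)` acting on the `E^c`-valued
coordinates of rational classes (`exists_sign_coord_galois`). [cite: GaoUllmo2025, Thm 3.1] -/
theorem span_Bp_le (Φ : CMTypeOn E) (p : ℕ) :
    Submodule.span ℂ (Bp Φ p : Set (Hr E (2 * p))) ≤
      Submodule.span ℂ {x | ∃ P : Set.powersetCard (Emb E) (2 * p),
        SatisfiesEq32 Φ (P : Finset (Emb E)) ∧ x = wedge E (2 * p) P} := by
  rw [Submodule.span_le]
  intro x hx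
  obtain ⟨hrat, hpp⟩ := Submodule.mem_inf.mp (show x ∈ Bp Φ p from hx)
  have hpp' : x ∈ Hpp Φ p := hpp
  have hset : {x : Hr E (2 * p) | ∃ P : Set.powersetCard (Emb E) (2 * p),
      SatisfiesEq32 Φ (P : Finset (Emb E)) ∧ x = wedge E (2 * p) P} =
      wedgeBasis E (2 * p) '' {P | SatisfiesEq32 Φ (P : Finset (Emb E))} := by
    ext y
    simp only [Set.mem_setOf_eq, Set.mem_image, wedgeBasis_apply]
    constructor
    · rintro ⟨P, h1, rfl⟩; exact ⟨P, h1, rfl⟩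
    · rintro ⟨P, h1, rfl⟩; exact ⟨P, h1, rfl⟩
  rw [SetLike.mem_coe, hset, Basis.mem_span_image]
  intro Q hQ σ
  have hQ' : (wedgeBasis E (2 * p)).repr x Q ≠ 0 := Finsupp.mem_support_iff.mp hQ
  obtain ⟨ε, -, hall⟩ := exists_sign_coord_galois σ (2 * p) Q
  obtain ⟨y, hy, hy'⟩ := hall x hrat
  have hyne : y ≠ 0 := by
    rintro rfl
    exact hQ' (by rw [← hy]; simp)
  have hσy : ((σ y : galoisClosure E) : ℂ) ≠ 0 := by
    intro h
    apply hyne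
    have h' : σ y = 0 := by exact_mod_cast h
    simpa using h'
  have hne : (wedgeBasis E (2 * p)).repr x (galActPC σ Q) ≠ 0 := by
    intro h0
    exact hσy (by rw [hy', h0, mul_zero])
  obtain ⟨h1, h2⟩ := type_of_repr_ne_zero_of_mem_Hpp Φ p hpp' _ hne
  rw [galActPC_val] at h1 h2
  rw [h1, h2]

end Thm31Le

end Literature.AlgebraicGeometry.GaoUllmo2025

end
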